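import Summits.CriticalPhenomena.PercolationContinuityZ3.Theorems.PercNearOneGluingNoHeavyConstsClusterSquareApicesQuad
import Summits.CriticalPhenomena.PercolationContinuityZ3.Theorems.PercNearOneGluingNoHeavyConstsClusterSquareApicesApexRoot
import HarnessLib

/-!
# Outerplanar graph plus independent apices: TS for EVERY triple of terminals

builds on p205010 (kernel theorem, internal audit signed; external expert review pending)

PAPER-2 track "percolation constants", part (ii), seat `prim-consts-1`, gen 22 (lane index
`run/shared/lean/prim/consts/CONSTANTS.md`, row A19; memo `FROM-prim-consts-1-g22-CROSS-LINKAGE.md` §2).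
Support file for the crux `NoHeavyLowerTail` (stmt-CriticalPhenomena-4575; `--supports`).  Theorems only; no definitions, no sorries.

THE CLASS (gen 20, `…ConstsClusterSquareApices.lean`): `H` on `Fin n` with a predicate `hub` (the apices) and rim positions `pos`;
(I) apices pairwise non-adjacent, (R) rim edges non-crossing, (F) no rim edge separates two neighbours of an apex, (L) chords of
distinct apices do not interleave, (L2) two apices have at most two common neighbours — outerplanar graphs with an independent set of
extra vertices drawn inside faces (wheels, fans, `K₂,ₘ`, chorded polygons with stars in faces, …).  THE RESULT:
**`Consts.tripleSplit_of_apices_all`** — TS `μ(a↮b, a↮c, b↮c)² ≤ μ(a↮b) μ(a↮c) μ(b↮c)` for ALL vertices `a, b, c` and every weight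
vector supported on `H`; concrete `Fin (N + M)` form **`Consts.tripleSplit_apices_all (a b c : Fin (N + M))`**.
Assembly: a rim vertex among `a, b, c` is a good root (`Consts.tripleSplit_of_apices_rim`, `…ApicesQuad.lean`); for three distinct
apices `h₁, h₂, h₃` (`Consts.Apices.tripleSplit_hubs`) either the sector condition holds at `h₁` (`Consts.tripleSplit_of_apices_apex`,
`…ApicesApexRoot.lean`), or a chord of `h₁` separates neighbours of `h₂` and `h₃`, and then NO chord of `h₂` separates neighbours of
`h₁` and `h₃` (`Consts.Apices.not_sep_sep`, `…ApicesSectors.lean`), i.e. the sector condition holds at `h₂`; coincident terminals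
give a vanishing left-hand side.  With this file the two-copy ("no quadruple clash", Gladkov2024 Thm. 4.3 + Thm. 5.2) programme for the
class is complete: TS everywhere, CSQ/DUU at every rim root and at every apex root satisfying the sector condition (which is necessary
there: `W₄` rooted at the hub).
Census (lane g22, exact enumeration): three apices and ≤ 5 rim vertices (19 840 / 390 144 graphs): 42 / 1 915 triples with a bad apex
root, never two (0); random search 6–8 rim vertices, 1.3·10⁶ graphs: 0 triples with two bad roots.
References: N. Gladkov, arXiv:2408.08457v2 (2024), Def. 4.2, Thm. 4.3, Lemma 3.1, Ex. 2.5, Thm. 5.2, Cor. 5.3; J. van den Berg,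
O. Häggström, J. Kahn, Random Structures Algorithms 29 (2006), §1; G. Chartrand, F. Harary, Ann. Inst. H. Poincaré B 3 (1967) 433–438.
-/

noncomputable section

open Classical

namespace Summit.CriticalPhenomena.PercolationContinuityZ3.Theorems

open MeasureTheory Finset Literature.Probability.LatticeModels Literature.Probability.Percolation

namespace Consts

/-- Symmetry of the two-point connection event. [folklore] -/
private theorem openConn_comm' {n : ℕ} (x y : Fin n) : (openConn x y : Set (BondConfig (Fin n))) = openConn y x :=
  Set.ext fun _ => ⟨fun h => SimpleGraph.Reachable.symm h, fun h => SimpleGraph.Reachable.symm h⟩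

/-- The complement of the trivial connection event `{x ↔ x}` is empty. [folklore] -/
private theorem compl_openConn_self {n : ℕ} (x : Fin n) : (openConn x x : Set (BondConfig (Fin n)))ᶜ = ∅ :=
  Set.ext fun _ => ⟨fun h => h (SimpleGraph.Reachable.refl x), fun h => h.elim⟩

namespace Apices

variable {n m : ℕ}

/-- **TS FOR THREE APICES** (`h₁ ≠ h₂, h₃`) of an outerplanar rim graph plus independent apices ((I)(R)(F)(L)(L2)):
`μ(h₁↮h₂, h₁↮h₃, h₂↮h₃)² ≤ μ(h₁↮h₂) μ(h₁↮h₃) μ(h₂↮h₃)`.  If the sector condition holds at `h₁`, root there; otherwise a chord of `h₁`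
separates neighbours of `h₂` and `h₃`, so by `Consts.Apices.not_sep_sep` the sector condition holds at `h₂`: root there and use the
symmetry of TS. [cite: Gladkov2024, Thm. 5.2, Cor. 5.3 (pattern) and Thm. 4.3] -/
theorem tripleSplit_hubs (w : Sym2 (Fin n) → unitInterval) (H : SimpleGraph (Fin n)) (hub : Fin n → Prop) (pos : Fin n → Fin m)
    (hH : ∀ u v, u ≠ v → (0 : ℝ) < w s(u, v) → H.Adj u v)
    (hpos : ∀ u v, ¬ hub u → ¬ hub v → pos u = pos v → u = v) (hI : ∀ u v, hub u → hub v → ¬ H.Adj u v)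
    (hR : ∀ p q r s : Fin n, ¬ hub p → ¬ hub q → ¬ hub r → ¬ hub s → H.Adj p q → H.Adj r s →
      pos p < pos r → pos r < pos q → pos q < pos s → False)
    (hF : ∀ x p q u v : Fin n, hub x → ¬ hub p → ¬ hub q → H.Adj p q → H.Adj x u → H.Adj x v →
      pos p < pos u → pos u < pos q → (pos q < pos v ∨ pos v < pos p) → False)
    (hL : ∀ x x' u v u' v' : Fin n, hub x → hub x' → x ≠ x' → H.Adj x u → H.Adj x v → H.Adj x' u' → H.Adj x' v' →
      pos u < pos u' → pos u' < pos v → pos v < pos v' → False)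
    (hL2 : ∀ x x' u v t : Fin n, hub x → hub x' → x ≠ x' → u ≠ v → u ≠ t → v ≠ t →
      H.Adj x u → H.Adj x v → H.Adj x t → H.Adj x' u → H.Adj x' v → H.Adj x' t → False)
    {h₁ h₂ h₃ : Fin n} (hh₁ : hub h₁) (hh₂ : hub h₂) (hh₃ : hub h₃) (h12 : h₁ ≠ h₂) (h13 : h₁ ≠ h₃) :
    (prodBernoulli w).real ((openConn h₁ h₂)ᶜ ∩ (openConn h₁ h₃)ᶜ ∩ (openConn h₂ h₃)ᶜ) ^ 2 ≤
      (prodBernoulli w).real (openConn h₁ h₂)ᶜ * (prodBernoulli w).real (openConn h₁ h₃)ᶜ *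
        (prodBernoulli w).real (openConn h₂ h₃)ᶜ := by
  by_cases hS₁ : ∀ α β t t' : Fin n, H.Adj h₁ α → H.Adj h₁ β → ¬ hub t → ¬ hub t' →
      ((¬ hub h₂ ∧ t = h₂) ∨ (hub h₂ ∧ H.Adj h₂ t)) → ((¬ hub h₃ ∧ t' = h₃) ∨ (hub h₃ ∧ H.Adj h₃ t')) →
      ¬ ((0 < (pos t - pos α).val ∧ (pos t - pos α).val < (pos β - pos α).val ∧ (pos β - pos α).val < (pos t' - pos α).val) ∨
        (0 < (pos t' - pos α).val ∧ (pos t' - pos α).val < (pos β - pos α).val ∧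
          (pos β - pos α).val < (pos t - pos α).val))
  · exact tripleSplit_of_apices_apex w h₁ h₂ h₃ H hub pos hH hpos hI hR hF hL hL2 hh₁ hS₁
  · push Not at hS₁
    obtain ⟨α, β, t₂, t₃, hα, hβ, ht₂, ht₃, r₂, r₃, s1⟩ := hS₁
    have e2 : H.Adj h₂ t₂ := r₂.elim (fun h => absurd hh₂ h.1) (fun h => h.2)
    have e3 : H.Adj h₃ t₃ := r₃.elim (fun h => absurd hh₃ h.1) (fun h => h.2)
    have hαr : ¬ hub α := fun h => hI h₁ α hh₁ h hα
    have hβr : ¬ hub β := fun h => hI h₁ β hh₁ h hβ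
    obtain ⟨G₀, Hp, C, -, -, -, c1, hx⟩ := exists_graphs H hub pos hR hF hL
    obtain ⟨-, -, -, -, xCC⟩ := hx α
    -- the sector condition holds at `h₂` with terminals `h₁, h₃`
    have hS₂ : ∀ γ δ t t' : Fin n, H.Adj h₂ γ → H.Adj h₂ δ → ¬ hub t → ¬ hub t' →
        ((¬ hub h₁ ∧ t = h₁) ∨ (hub h₁ ∧ H.Adj h₁ t)) → ((¬ hub h₃ ∧ t' = h₃) ∨ (hub h₃ ∧ H.Adj h₃ t')) →
        ¬ ((0 < (pos t - pos γ).val ∧ (pos t - pos γ).val < (pos δ - pos γ).val ∧ (pos δ - pos γ).val < (pos t' - pos γ).val) ∨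
          (0 < (pos t' - pos γ).val ∧ (pos t' - pos γ).val < (pos δ - pos γ).val ∧
            (pos δ - pos γ).val < (pos t - pos γ).val)) := by
      intro γ δ t₁ t₃' hγ hδ ht₁ ht₃' r₁ r₃' s2
      have e1 : H.Adj h₁ t₁ := r₁.elim (fun h => absurd hh₁ h.1) (fun h => h.2)
      have e3' : H.Adj h₃ t₃' := r₃'.elim (fun h => absurd hh₃ h.1) (fun h => h.2)
      have hγr : ¬ hub γ := fun h => hI h₂ γ hh₂ h hγ
      have hδr : ¬ hub δ := fun h => hI h₂ δ hh₂ h hδ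
      have hγδ : γ ≠ δ := by
        rintro rfl
        rw [NonCrossing.rot_self] at s2
        omega
      obtain ⟨s2', n1, n2, n3, n4⟩ := sep_recut (pos := pos) α γ s2
      exact not_sep_sep hpos c1 xCC hαr hL2 hh₁ hh₂ hh₃ h12 h13 hβr ht₂ ht₃ hγr hδr ht₁ ht₃' hα hβ e1 e2 hγ hδ e3 e3'
        hγδ s1 s2' n1 n2 n3 n4
    have T := tripleSplit_of_apices_apex w h₂ h₁ h₃ H hub pos hH hpos hI hR hF hL hL2 hh₂ hS₂
    rw [openConn_comm' h₂ h₁, Set.inter_right_comm, mul_right_comm] at T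
    exact T

end Apices

/-! ### TS for every triple -/

section Fin

variable {n m : ℕ} (w : Sym2 (Fin n) → unitInterval) (a b c : Fin n) (H : SimpleGraph (Fin n)) (hub : Fin n → Prop)
  (pos : Fin n → Fin m)

/-- **TS FOR EVERY TRIPLE OF TERMINALS of an outerplanar rim graph plus an independent set of apices inside faces** (hypotheses (I), (R),
(F), (L), (L2) as in `Consts.Apices.unlinked`; `H ⊇` positive pairs of `w`; `a, b, c` ANY vertices):
`μ(a↮b, a↮c, b↮c)² ≤ μ(a↮b) · μ(a↮c) · μ(b↮c)`.  A rim vertex among the three is a good root (`Consts.tripleSplit_of_apices_rim`);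
three apices have a good root by `Consts.Apices.tripleSplit_hubs`; a root coinciding with a terminal makes the left-hand side vanish.
[cite: Gladkov2024, Thm. 5.2, Cor. 5.3 (pattern) and Thm. 4.3] -/
theorem tripleSplit_of_apices_all (hH : ∀ u v, u ≠ v → (0 : ℝ) < w s(u, v) → H.Adj u v)
    (hpos : ∀ u v, ¬ hub u → ¬ hub v → pos u = pos v → u = v) (hI : ∀ u v, hub u → hub v → ¬ H.Adj u v)
    (hR : ∀ p q r s : Fin n, ¬ hub p → ¬ hub q → ¬ hub r → ¬ hub s → H.Adj p q → H.Adj r s →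
      pos p < pos r → pos r < pos q → pos q < pos s → False)
    (hF : ∀ x p q u v : Fin n, hub x → ¬ hub p → ¬ hub q → H.Adj p q → H.Adj x u → H.Adj x v →
      pos p < pos u → pos u < pos q → (pos q < pos v ∨ pos v < pos p) → False)
    (hL : ∀ x x' u v u' v' : Fin n, hub x → hub x' → x ≠ x' → H.Adj x u → H.Adj x v → H.Adj x' u' → H.Adj x' v' →
      pos u < pos u' → pos u' < pos v → pos v < pos v' → False)
    (hL2 : ∀ x x' u v t : Fin n, hub x → hub x' → x ≠ x' → u ≠ v → u ≠ t → v ≠ t →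
      H.Adj x u → H.Adj x v → H.Adj x t → H.Adj x' u → H.Adj x' v → H.Adj x' t → False) :
    (prodBernoulli w).real ((openConn a b)ᶜ ∩ (openConn a c)ᶜ ∩ (openConn b c)ᶜ) ^ 2 ≤
      (prodBernoulli w).real (openConn a b)ᶜ * (prodBernoulli w).real (openConn a c)ᶜ *
        (prodBernoulli w).real (openConn b c)ᶜ := by
  by_cases ha : hub a
  · by_cases hb : hub b
    · by_cases hc : hub c
      · -- three apices
        by_cases hab : a = b
        · subst hab; rw [compl_openConn_self]; simp
        by_cases hac : a = c
        · subst hac; rw [compl_openConn_self]; simp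
        exact Apices.tripleSplit_hubs w H hub pos hH hpos hI hR hF hL hL2 ha hb hc hab hac
      · -- `c` on the rim: root at `c`
        have T := tripleSplit_of_apices_rim w c a b H hub pos hH hpos hI hR hF hL hL2 hc
        rw [openConn_comm' c a, openConn_comm' c b] at T
        calc (prodBernoulli w).real ((openConn a b)ᶜ ∩ (openConn a c)ᶜ ∩ (openConn b c)ᶜ) ^ 2
            = (prodBernoulli w).real ((openConn a c)ᶜ ∩ (openConn b c)ᶜ ∩ (openConn a b)ᶜ) ^ 2 := by
              rw [Set.inter_comm ((openConn a c)ᶜ ∩ (openConn b c)ᶜ), ← Set.inter_assoc]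
          _ ≤ (prodBernoulli w).real (openConn a c)ᶜ * (prodBernoulli w).real (openConn b c)ᶜ *
                (prodBernoulli w).real (openConn a b)ᶜ := T
          _ = _ := by ring
    · -- `b` on the rim: root at `b`
      have T := tripleSplit_of_apices_rim w b a c H hub pos hH hpos hI hR hF hL hL2 hb
      rw [openConn_comm' b a, Set.inter_right_comm, mul_right_comm] at T
      exact T
  · exact tripleSplit_of_apices_rim w a b c H hub pos hH hpos hI hR hF hL hL2 ha

end Fin

/-! ### Concrete form: vertices `Fin (N + M)`, rim `Fin.castAdd M i` (natural cyclic order), apices = the last `M` vertices -/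

/-- **TS for EVERY triple of the weighted "polygon with chords plus `M` interior vertices" graphs on `Fin (N + M)`**: rim vertices
`Fin.castAdd M i` (`i : Fin N`) in their natural cyclic order, apices = the vertices with value `≥ N`; `w` any weight vector with (I)
no positive apex–apex pair, (R) positive rim–rim pairs non-crossing, (F) none of them separating two rim vertices positively joined to
one apex, (L) no two apices with interleaving positive neighbour pairs, (L2) no two apices with three common positive neighbours.
Then for ALL `a, b, c`: `μ(a↮b, a↮c, b↮c)² ≤ μ(a↮b) μ(a↮c) μ(b↮c)`. [cite: Gladkov2024, Thm. 5.2, Cor. 5.3 (pattern) and Thm. 4.3] -/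
theorem tripleSplit_apices_all (N M : ℕ) (w : Sym2 (Fin (N + M)) → unitInterval)
    (hI : ∀ x x' : Fin (N + M), N ≤ x.val → N ≤ x'.val → ¬ (0 : ℝ) < w s(x, x'))
    (hR : ∀ p q r s : Fin N, (0 : ℝ) < w s(Fin.castAdd M p, Fin.castAdd M q) → (0 : ℝ) < w s(Fin.castAdd M r, Fin.castAdd M s) →
      p < r → r < q → q < s → False)
    (hF : ∀ x : Fin (N + M), N ≤ x.val → ∀ p q u v : Fin N, (0 : ℝ) < w s(Fin.castAdd M p, Fin.castAdd M q) →
      (0 : ℝ) < w s(x, Fin.castAdd M u) → (0 : ℝ) < w s(x, Fin.castAdd M v) → p < u → u < q → (q < v ∨ v < p) → False)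
    (hL : ∀ x x' : Fin (N + M), N ≤ x.val → N ≤ x'.val → x ≠ x' → ∀ u v u' v' : Fin N, (0 : ℝ) < w s(x, Fin.castAdd M u) →
      (0 : ℝ) < w s(x, Fin.castAdd M v) → (0 : ℝ) < w s(x', Fin.castAdd M u') → (0 : ℝ) < w s(x', Fin.castAdd M v') →
      u < u' → u' < v → v < v' → False)
    (hL2 : ∀ x x' : Fin (N + M), N ≤ x.val → N ≤ x'.val → x ≠ x' → ∀ u v t : Fin N, u ≠ v → u ≠ t → v ≠ t →
      (0 : ℝ) < w s(x, Fin.castAdd M u) → (0 : ℝ) < w s(x, Fin.castAdd M v) → (0 : ℝ) < w s(x, Fin.castAdd M t) →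
      (0 : ℝ) < w s(x', Fin.castAdd M u) → (0 : ℝ) < w s(x', Fin.castAdd M v) → (0 : ℝ) < w s(x', Fin.castAdd M t) → False)
    (a b c : Fin (N + M)) :
    (prodBernoulli w).real ((openConn a b)ᶜ ∩ (openConn a c)ᶜ ∩ (openConn b c)ᶜ) ^ 2 ≤
      (prodBernoulli w).real (openConn a b)ᶜ * (prodBernoulli w).real (openConn a c)ᶜ *
        (prodBernoulli w).real (openConn b c)ᶜ := by
  let H : SimpleGraph (Fin (N + M)) := SimpleGraph.fromRel fun u v => (0 : ℝ) < w s(u, v)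
  have hH : ∀ u v, u ≠ v → (0 : ℝ) < w s(u, v) → H.Adj u v := fun u v huv hw =>
    (SimpleGraph.fromRel_adj _ u v).2 ⟨huv, Or.inl hw⟩
  have hH' : ∀ u v, H.Adj u v → (0 : ℝ) < w s(u, v) := by
    intro u v huv
    rcases (SimpleGraph.fromRel_adj _ u v).1 huv with ⟨_, e | e⟩
    · exact e
    · rwa [Sym2.eq_swap] at e
  -- every rim vertex is a `castAdd`
  have hcast : ∀ u : Fin (N + M), ¬ N ≤ u.val → ∃ i : Fin N, u = Fin.castAdd M i := fun u hu =>
    ⟨⟨u.val, by omega⟩, Fin.ext (by simp)⟩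
  have hlt : ∀ p r : Fin N, Fin.castAdd M p < Fin.castAdd M r → p < r := fun p r h => by
    rw [Fin.lt_def] at h ⊢; simpa using h
  refine tripleSplit_of_apices_all w a b c H (fun v => N ≤ v.val) id hH
    (fun u v _ _ e => e) (fun u v hu hv e => hI u v hu hv (hH' u v e)) ?_ ?_ ?_ ?_
  · intro p q r s hp hq hr hs hpq hrs l1 l2 l3
    obtain ⟨p, rfl⟩ := hcast p hp; obtain ⟨q, rfl⟩ := hcast q hq
    obtain ⟨r, rfl⟩ := hcast r hr; obtain ⟨s, rfl⟩ := hcast s hs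
    exact hR p q r s (hH' _ _ hpq) (hH' _ _ hrs) (hlt _ _ l1) (hlt _ _ l2) (hlt _ _ l3)
  · intro x p q u v hx hp hq hpq hu hv l1 l2 l3
    obtain ⟨p, rfl⟩ := hcast p hp; obtain ⟨q, rfl⟩ := hcast q hq
    obtain ⟨u, rfl⟩ := hcast u (fun h => hI x _ hx h (hH' _ _ hu))
    obtain ⟨v, rfl⟩ := hcast v (fun h => hI x _ hx h (hH' _ _ hv))
    refine hF x hx p q u v (hH' _ _ hpq) (hH' _ _ hu) (hH' _ _ hv) (hlt _ _ l1) (hlt _ _ l2) ?_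
    rcases l3 with l3 | l3
    · exact Or.inl (hlt _ _ l3)
    · exact Or.inr (hlt _ _ l3)
  · intro x x' u v u' v' hx hx' hxx' hu hv hu' hv' l1 l2 l3
    obtain ⟨u, rfl⟩ := hcast u (fun h => hI x _ hx h (hH' _ _ hu))
    obtain ⟨v, rfl⟩ := hcast v (fun h => hI x _ hx h (hH' _ _ hv))
    obtain ⟨u', rfl⟩ := hcast u' (fun h => hI x' _ hx' h (hH' _ _ hu'))
    obtain ⟨v', rfl⟩ := hcast v' (fun h => hI x' _ hx' h (hH' _ _ hv'))
    exact hL x x' hx hx' hxx' u v u' v' (hH' _ _ hu) (hH' _ _ hv) (hH' _ _ hu') (hH' _ _ hv') (hlt _ _ l1) (hlt _ _ l2)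
      (hlt _ _ l3)
  · intro x x' u v t hx hx' hxx' huv hut hvt hu hv ht hu' hv' ht'
    obtain ⟨u, rfl⟩ := hcast u (fun h => hI x _ hx h (hH' _ _ hu))
    obtain ⟨v, rfl⟩ := hcast v (fun h => hI x _ hx h (hH' _ _ hv))
    obtain ⟨t, rfl⟩ := hcast t (fun h => hI x _ hx h (hH' _ _ ht))
    exact hL2 x x' hx hx' hxx' u v t (fun e => huv (e ▸ rfl)) (fun e => hut (e ▸ rfl)) (fun e => hvt (e ▸ rfl))
      (hH' _ _ hu) (hH' _ _ hv) (hH' _ _ ht) (hH' _ _ hu') (hH' _ _ hv') (hH' _ _ ht')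

end Consts

end Summit.CriticalPhenomena.PercolationContinuityZ3.Theorems
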